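import Summits.Parity.BatemanHorn.Theorems.SelbergDelangeRigidityDefs
import Summits.Parity.BatemanHorn.Theorems.SelbergDelangeRigidityLSDRealSegmentEulerFactorAux
import HarnessLib

/-!
# Route `SelbergDelangeRigidity`, crux `LSDRealSegment` (stmt-Parity-9770), line
# `product-anatomy-subcritical`: the registered stub `stub_eulerFactor`

For a Bateman–Horn system `f = (f₁, …, f_k)` the line's EXPLICIT Euler factor
`λ_F(z) = eulerFactor f z = lim_N ∏_{p ≤ N} E_p(z) (1 − 1/p)^{k(z−1)}` (ordered limit; the local tilted means
`E_p(z) = localFactor f p z = 1 + (z − 1) Σ_{a ≥ 0} ρ_F(p^{a+1}) p^{−a−1} z^a`, `ρ_F(m) = polyRootCountMod f m`, of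
`Summits/Parity/BatemanHorn/Theorems/SelbergDelangeRigidityDefs.lean`) is HOLOMORPHIC on `|z| < 2`.

Proof.
1. (`…EulerFactorAux.lean`) `ρ_F(p^a) ≤ C(f)` for all primes `p` and all `a`, and `ρ_F(p^a) = ρ_F(p) ≤ Σ deg fᵢ`
   for `p > P₀`, `a ≥ 1` (the product `∏ fᵢ` is separable; Hensel / Nagell).
2. Hence the series of `E_p` has radius `≥ p ≥ 2`: `E_p` is holomorphic on `|z| < 2` (Weierstrass `M`-test on
   `|z| < r < 2`, Mathlib's `Complex.differentiableOn_tsum_of_summable_norm`) — `differentiableOn_localFactor`;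
   and for `p ≥ 3`, `‖z‖ ≤ 2`: `E_p(z) = 1 + (z − 1) ρ_F(p)/p + O(D/p²)` — `norm_localFactor_sub_le`.
3. Adjoin to the `p`-th factor the scalar `exp((z − 1)(k − ρ_F(p))/p)`: with `|log(1 − 1/p) + 1/p| ≤ 2/p²` the
   regularised factor is `1 + O(p⁻²)` uniformly on `‖z‖ ≤ 2` (`exists_norm_localFactor_mul_exp_sub_one_le`, as on
   the sibling line `beta-thinned-root-kernel` of stmt-Parity-11292, whose capped local factor is a polynomial), so
   the regularised product converges locally uniformly on the ball to a holomorphic `Φ`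
   (`Summable.hasProdLocallyUniformlyOn_one_add`, `TendstoLocallyUniformlyOn.differentiableOn`); the scalars
   multiply to `exp(−(z − 1) Σ_{p≤N}(k − ρ_F(p))/p)`, which converges by the ORDERED convergence of
   `Σ_p (k − ρ_F(p))/p` (`AZFG2020_tendsto_sum_sub_omega_div_holds`, Bateman–Horn 1962 / AZFG 2020 (5.4.4), PROVED
   in the tree).  Hence `λ_F = Φ · exp(−(z−1)L)` on the ball (`Filter.Tendsto.limUnder_eq`).
The radius `2` is sharp (`Theorems/LSDRealSegment/Negative/SharpRadius.lean`); the pin `λ_F(0) = C(f)` is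
`eulerFactor_zero` of the Defs file.
-/

open Filter Finset Polynomial
open scoped BigOperators Topology Classical

namespace Summit.Parity.BatemanHorn.Cruxes.LSDRealSegment.ProductAnatomySubcritical

open Literature.NumberTheory.Sieve
open ArithmeticFunction (cardFactors)
noncomputable section

variable {k : ℕ} (f : Fin k → ℤ[X])

/-! ### The local factor is a power series of radius `≥ p` -/

/-- Size of one term of the local series: `‖(ρ_F(p^{a+1})/p^{a+1}) z^a‖ ≤ (C/p^{a+1}) r^a` for `‖z‖ ≤ r`,
`ρ_F(p^{a+1}) ≤ C`. [folklore] -/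
theorem norm_localTerm_le {p C a : ℕ} (hC : polyRootCountMod f (p ^ (a + 1)) ≤ C) {z : ℂ} {r : ℝ}
    (hz : ‖z‖ ≤ r) :
    ‖((polyRootCountMod f (p ^ (a + 1)) : ℂ) / (p : ℂ) ^ (a + 1)) * z ^ a‖ ≤
      (C : ℝ) / (p : ℝ) ^ (a + 1) * r ^ a := by
  rw [norm_mul, norm_div, norm_pow, norm_pow, Complex.norm_natCast, Complex.norm_natCast]
  have hr : 0 ≤ r := (norm_nonneg z).trans hz
  have hC' : (polyRootCountMod f (p ^ (a + 1)) : ℝ) ≤ C := by exact_mod_cast hC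
  gcongr

/-- The coefficient series `Σ_a (ρ_F(p^{a+1})/p^{a+1}) z^a` is holomorphic on `|z| < r` for every `r < p`
once `ρ_F(p^a) ≤ C` for all `a` (terms `≤ (C/p)(r/p)^a`, Weierstrass M-test). [folklore] -/
theorem differentiableOn_localSeries {p : ℕ} (hp : 0 < p) {C : ℕ}
    (hC : ∀ a, polyRootCountMod f (p ^ a) ≤ C) {r : ℝ} (hr0 : 0 ≤ r) (hr : r < p) :
    DifferentiableOn ℂ
      (fun z : ℂ => ∑' a : ℕ, ((polyRootCountMod f (p ^ (a + 1)) : ℂ) / (p : ℂ) ^ (a + 1)) * z ^ a)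
      (Metric.ball 0 r) := by
  have hp0 : (0 : ℝ) < p := by exact_mod_cast hp
  have hq1 : r / p < 1 := (div_lt_one hp0).mpr hr
  have hq0 : 0 ≤ r / p := div_nonneg hr0 hp0.le
  refine Complex.differentiableOn_tsum_of_summable_norm
    (u := fun a : ℕ => (C : ℝ) / p * (r / p) ^ a) ((summable_geometric_of_lt_one hq0 hq1).mul_left _)
    (fun a => by fun_prop) Metric.isOpen_ball fun a w hw => ?_
  have hw : ‖w‖ ≤ r := (mem_ball_zero_iff.mp hw).le
  calc ‖((polyRootCountMod f (p ^ (a + 1)) : ℂ) / (p : ℂ) ^ (a + 1)) * w ^ a‖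
      ≤ (C : ℝ) / (p : ℝ) ^ (a + 1) * r ^ a := norm_localTerm_le f (hC (a + 1)) hw
    _ = (C : ℝ) / p * (r / p) ^ a := by rw [div_pow, pow_succ]; field_simp

/-- **`E_p = localFactor f p` is holomorphic on `|z| < 2`** whenever `p ≥ 2` and the counts `ρ_F(p^a)` are
bounded in `a` (localise to `|z| < r < 2 ≤ p`). [folklore] -/
theorem differentiableOn_localFactor {p : ℕ} (hp : 2 ≤ p) {C : ℕ}
    (hC : ∀ a, polyRootCountMod f (p ^ a) ≤ C) :
    DifferentiableOn ℂ (localFactor f p) (Metric.ball 0 2) := by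
  intro z hz
  have hz2 : ‖z‖ < 2 := mem_ball_zero_iff.mp hz
  set r : ℝ := (‖z‖ + 2) / 2 with hr
  have hn := norm_nonneg z
  have hzr : ‖z‖ < r := by rw [hr]; linarith
  have hr0 : 0 ≤ r := by rw [hr]; linarith
  have hrp : r < p := by
    have h2 : (2 : ℝ) ≤ p := by exact_mod_cast hp
    rw [hr]; linarith
  have hS := differentiableOn_localSeries f (by omega) hC hr0 hrp
  have hSz := hS.differentiableAt (Metric.isOpen_ball.mem_nhds (mem_ball_zero_iff.mpr hzr))
  refine DifferentiableAt.differentiableWithinAt ?_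
  have h1 : DifferentiableAt ℂ (fun w : ℂ => w - 1) z := differentiableAt_id.sub_const 1
  have h2 : DifferentiableAt ℂ (fun w : ℂ => 1 + (w - 1) *
      ∑' a : ℕ, ((polyRootCountMod f (p ^ (a + 1)) : ℂ) / (p : ℂ) ^ (a + 1)) * w ^ a) z :=
    (h1.fun_mul hSz).const_add (1 : ℂ)
  unfold localFactor
  exact h2

/-! ### The local factor at a large prime: `E_p(z) = 1 + (z − 1) ρ_F(p)/p + O(p⁻²)` -/

/-- For `p ≥ 3` with `ρ_F(p^a) ≤ D` (`a ≥ 1`) and `‖z‖ ≤ 2`: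
`‖E_p(z) − (1 + (z − 1) ρ_F(p)/p)‖ ≤ 18 D / p²` (the tail `Σ_{a ≥ 1}` of the series is
`≤ (2D/p²) Σ_a (2/p)^a ≤ 6D/p²`, and `‖z − 1‖ ≤ 3`). [folklore] -/
theorem norm_localFactor_sub_le {p : ℕ} (h3 : 3 ≤ p) {D : ℕ}
    (hD : ∀ a, 1 ≤ a → polyRootCountMod f (p ^ a) ≤ D) {z : ℂ} (hz : ‖z‖ ≤ 2) :
    ‖localFactor f p z - (1 + (z - 1) * (polyRootCountMod f p : ℂ) / p)‖ ≤ 18 * D / (p : ℝ) ^ 2 := by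
  have hp0 : (0 : ℝ) < p := by exact_mod_cast (show 0 < p by omega)
  set c : ℕ → ℂ := fun a => ((polyRootCountMod f (p ^ (a + 1)) : ℂ) / (p : ℂ) ^ (a + 1)) with hc
  set q : ℝ := 2 / p with hq
  have hq0 : 0 ≤ q := by positivity
  have hp3 : (3 : ℝ) ≤ p := by exact_mod_cast h3
  have hq1 : q < 1 := by rw [hq, div_lt_one hp0]; linarith
  have hq3 : (1 - q)⁻¹ ≤ 3 := by
    rw [inv_le_comm₀ (by linarith) (by norm_num : (0 : ℝ) < 3), hq, le_sub_comm, div_le_iff₀ hp0]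
    linarith
  have hterm : ∀ a : ℕ, ‖c (a + 1) * z ^ (a + 1)‖ ≤ 2 * D / (p : ℝ) ^ 2 * q ^ a := by
    intro a
    calc ‖c (a + 1) * z ^ (a + 1)‖ ≤ (D : ℝ) / (p : ℝ) ^ (a + 1 + 1) * 2 ^ (a + 1) :=
          norm_localTerm_le f (hD (a + 1 + 1) (by omega)) hz
      _ = 2 * D / (p : ℝ) ^ 2 * q ^ a := by rw [hq, div_pow]; field_simp; ring
  have hg : HasSum (fun a : ℕ => 2 * D / (p : ℝ) ^ 2 * q ^ a) (2 * D / (p : ℝ) ^ 2 * (1 - q)⁻¹) :=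
    (hasSum_geometric_of_lt_one hq0 hq1).mul_left _
  have hs1 : Summable (fun a : ℕ => c (a + 1) * z ^ (a + 1)) := Summable.of_norm_bounded hg.summable hterm
  have hsum : Summable (fun a : ℕ => c a * z ^ a) :=
    (summable_nat_add_iff (f := fun a : ℕ => c a * z ^ a) 1).mp hs1
  have hsplit : ∑' a, c a * z ^ a = c 0 * z ^ 0 + ∑' a, c (a + 1) * z ^ (a + 1) :=
    hsum.tsum_eq_zero_add
  have hc0 : c 0 = (polyRootCountMod f p : ℂ) / p := by simp [hc]
  have hR : ‖∑' a, c (a + 1) * z ^ (a + 1)‖ ≤ 2 * D / (p : ℝ) ^ 2 * (1 - q)⁻¹ :=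
    tsum_of_norm_bounded hg hterm
  have hz1 : ‖z - 1‖ ≤ 3 := (norm_sub_le z 1).trans (by rw [norm_one]; linarith)
  have hE : localFactor f p z - (1 + (z - 1) * (polyRootCountMod f p : ℂ) / p) =
      (z - 1) * ∑' a, c (a + 1) * z ^ (a + 1) := by
    have h1 : localFactor f p z = 1 + (z - 1) * ∑' a, c a * z ^ a := rfl
    rw [h1, hsplit, pow_zero, mul_one, hc0]
    ring
  rw [hE, norm_mul]
  calc ‖z - 1‖ * ‖∑' a, c (a + 1) * z ^ (a + 1)‖ ≤ 3 * (2 * D / (p : ℝ) ^ 2 * (1 - q)⁻¹) := by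
        gcongr
    _ ≤ 3 * (2 * D / (p : ℝ) ^ 2 * 3) := by gcongr
    _ = 18 * D / (p : ℝ) ^ 2 := by ring

/-! ### The regularised local factor is `1 + O(p⁻²)` -/

/-- **The regularised `p`-th factor is `1 + O(p⁻²)` uniformly on `‖z‖ ≤ 2`.** For a Bateman–Horn
system and all primes `p > P₁`:
`‖E_p(z) · exp((z − 1)(k log(1 − 1/p) + (k − ρ_F(p))/p)) − 1‖ ≤ C/p²` (`ρ_F(p^a) = ρ_F(p) ≤ Σ deg fᵢ`
beyond `P₀`, `|log(1 − 1/p) + 1/p| ≤ 2/p²`, and `E_p(z) = 1 + (z − 1)ρ_F(p)/p + O(p⁻²)`), via the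
elementary `‖(1 + A + r)e^w − 1‖ ≤ 3‖r‖ + (1 + ‖A‖)‖w‖² + ‖A + w‖ + ‖A‖‖w‖` (`‖w‖ ≤ 1`). [folklore] -/
theorem exists_norm_localFactor_mul_exp_sub_one_le (hf : IsBatemanHornSystem f) :
    ∃ (P₁ : ℕ) (C : ℝ), 0 ≤ C ∧ ∀ p : ℕ, p.Prime → P₁ < p → ∀ z : ℂ, ‖z‖ ≤ 2 →
      ‖localFactor f p z * Complex.exp ((z - 1) *
          (((k : ℝ) * Real.log (1 - 1 / (p : ℝ)) + ((k : ℝ) - polyRootCountMod f p) / p : ℝ) : ℂ)) -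
        1‖ ≤ C / (p : ℝ) ^ 2 := by
  -- the elementary inequality of the sibling line (`norm_one_add_add_mul_exp_sub_one_le` in
  -- `AlmostPrimeZerosSystemLSDRealSegmentEulerFactor.lean`): `‖e^w‖ ≤ 3`, `‖e^w − 1 − w‖ ≤ ‖w‖²`
  have key : ∀ A r w : ℂ, ‖w‖ ≤ 1 → ‖(1 + A + r) * Complex.exp w - 1‖ ≤
      3 * ‖r‖ + (1 + ‖A‖) * ‖w‖ ^ 2 + ‖A + w‖ + ‖A‖ * ‖w‖ := by
    intro A r w hw
    have hexp : ‖Complex.exp w‖ ≤ 3 :=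
      (Complex.norm_exp_le_exp_norm w).trans
        ((Real.exp_le_exp.mpr hw).trans Real.exp_one_lt_three.le)
    have h1 : (1 + A + r) * Complex.exp w - 1 =
        r * Complex.exp w + (1 + A) * (Complex.exp w - 1 - w) + ((A + w) + A * w) := by ring
    have e1 : ‖r * Complex.exp w‖ ≤ ‖r‖ * 3 := by
      rw [norm_mul]
      gcongr
    have e2 : ‖(1 + A) * (Complex.exp w - 1 - w)‖ ≤ (1 + ‖A‖) * ‖w‖ ^ 2 := by
      rw [norm_mul]
      exact mul_le_mul ((norm_add_le _ _).trans_eq (by rw [norm_one]))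
        (Complex.norm_exp_sub_one_sub_id_le hw) (norm_nonneg _) (by positivity)
    have e3 : ‖(A + w) + A * w‖ ≤ ‖A + w‖ + ‖A‖ * ‖w‖ :=
      (norm_add_le _ _).trans_eq (by rw [norm_mul])
    rw [h1]
    calc ‖r * Complex.exp w + (1 + A) * (Complex.exp w - 1 - w) + ((A + w) + A * w)‖
        ≤ ‖r * Complex.exp w‖ + ‖(1 + A) * (Complex.exp w - 1 - w)‖ + ‖(A + w) + A * w‖ :=
          norm_add₃_le
      _ ≤ ‖r‖ * 3 + (1 + ‖A‖) * ‖w‖ ^ 2 + (‖A + w‖ + ‖A‖ * ‖w‖) := add_le_add_three e1 e2 e3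
      _ = _ := by ring
  obtain ⟨P₀, hP₀⟩ := exists_polyRootCountMod_prime_pow_eq_of_system hf
  set D : ℕ := ∑ i, (f i).natDegree
  refine ⟨P₀ + 3 * (2 * k + D) + 3,
    3 * (18 * (D : ℝ)) + (1 + 3 * D) * (3 * (2 * k + D)) ^ 2 + 6 * k + 3 * D * (3 * (2 * k + D)),
    by positivity, ?_⟩
  intro p hp hp1 z hz
  have hDa : ∀ a, 1 ≤ a → polyRootCountMod f (p ^ a) ≤ D := fun a ha => by
    obtain ⟨h1, h2⟩ := hP₀ p hp (by omega) a ha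
    exact h1.le.trans h2
  have hp2 : (2 : ℝ) ≤ p := by exact_mod_cast hp.two_le
  have hp0 : (0 : ℝ) < p := by linarith
  -- notation
  set ω : ℕ := polyRootCountMod f p
  set ℓ : ℝ := Real.log (1 - 1 / (p : ℝ))
  set c : ℝ := (k : ℝ) * ℓ + ((k : ℝ) - ω) / p with hc
  -- the small parameter `u = 1/p`
  set u : ℝ := 1 / p with hu
  have hu0 : 0 ≤ u := by positivity
  have hu2 : u ≤ 1 / 2 := by rw [hu]; gcongr
  have hu1 : u ≤ 1 := by linarith
  have huu : u ^ 2 ≤ u := by nlinarith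
  have hW1 : 3 * (2 * k + D) * u ≤ 1 := by
    rw [hu, mul_one_div, div_le_one hp0]
    exact_mod_cast (show 3 * (2 * k + D) ≤ p by omega)
  have hωD : (ω : ℝ) ≤ D := by
    have h := hDa 1 le_rfl
    rw [pow_one] at h
    exact_mod_cast h
  -- the logarithm: `c = t − ω u` with `t = k (ℓ + u) = O(u²)`
  have hℓu : |ℓ + u| ≤ 2 * u ^ 2 := abs_log_one_sub_add_le hu0 hu2
  set t : ℝ := k * (ℓ + u) with ht
  have htu : |t| ≤ 2 * k * u ^ 2 := by
    rw [ht, abs_mul, Nat.abs_cast]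
    calc (k : ℝ) * |ℓ + u| ≤ k * (2 * u ^ 2) := by gcongr
      _ = _ := by ring
  have hct : c = t - ω * u := by
    rw [hc, ht, hu]
    field_simp
    ring
  have hcu : |c| ≤ (2 * k + D) * u := by
    rw [hct]
    calc |t - ω * u| ≤ |t| + |(ω : ℝ) * u| := abs_sub _ _
      _ ≤ 2 * k * u ^ 2 + D * u := by
          rw [abs_of_nonneg (by positivity : (0 : ℝ) ≤ (ω : ℝ) * u)]
          gcongr
      _ ≤ 2 * k * u + D * u := by gcongr
      _ = (2 * k + D) * u := by ring
  -- the complex pieces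
  have hz1 : ‖z - 1‖ ≤ 3 := (norm_sub_le z 1).trans (by rw [norm_one]; linarith)
  set A : ℂ := (z - 1) * (ω : ℂ) / p with hA
  set w : ℂ := (z - 1) * (c : ℂ) with hw
  set r : ℂ := localFactor f p z - (1 + (z - 1) * (ω : ℂ) / p) with hr
  have hrD : ‖r‖ ≤ 18 * D * u ^ 2 := by
    have h := norm_localFactor_sub_le f (show 3 ≤ p by omega) hDa hz
    rw [hu, one_div, inv_pow, ← div_eq_mul_inv]
    exact h
  have hAn : ‖A‖ ≤ 3 * D * u := by
    rw [hA, norm_div, norm_mul, Complex.norm_natCast, Complex.norm_natCast]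
    calc ‖z - 1‖ * ω / p ≤ 3 * D / p := by gcongr
      _ = 3 * D * u := by rw [hu]; ring
  have hwn : ‖w‖ ≤ 3 * (2 * k + D) * u := by
    rw [hw, norm_mul, Complex.norm_real, Real.norm_eq_abs]
    calc ‖z - 1‖ * |c| ≤ 3 * ((2 * k + D) * u) := by gcongr
      _ = _ := by ring
  have hw1 : ‖w‖ ≤ 1 := hwn.trans hW1
  have hAw : ‖A + w‖ ≤ 6 * k * u ^ 2 := by
    have e : A + w = (z - 1) * (t : ℂ) := by
      rw [hA, hw, hct, hu]
      push_cast
      field_simp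
      ring
    rw [e, norm_mul, Complex.norm_real, Real.norm_eq_abs]
    calc ‖z - 1‖ * |t| ≤ 3 * (2 * k * u ^ 2) := by gcongr
      _ = _ := by ring
  have hE : localFactor f p z * Complex.exp ((z - 1) * (c : ℂ)) - 1 =
      (1 + A + r) * Complex.exp w - 1 := by
    rw [hr, hA, hw]
    ring
  rw [hE]
  calc ‖(1 + A + r) * Complex.exp w - 1‖
      ≤ 3 * ‖r‖ + (1 + ‖A‖) * ‖w‖ ^ 2 + ‖A + w‖ + ‖A‖ * ‖w‖ :=
        key A r w hw1
    _ ≤ 3 * (18 * D * u ^ 2) + (1 + 3 * D * u) * (3 * (2 * k + D) * u) ^ 2 +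
          6 * k * u ^ 2 + (3 * D * u) * (3 * (2 * k + D) * u) := by gcongr
    _ = u ^ 2 * (3 * (18 * (D : ℝ)) + (1 + 3 * D * u) * (3 * (2 * k + D)) ^ 2 + 6 * k +
          3 * D * (3 * (2 * k + D))) := by ring
    _ ≤ u ^ 2 * (3 * (18 * (D : ℝ)) + (1 + 3 * D * 1) * (3 * (2 * k + D)) ^ 2 + 6 * k +
          3 * D * (3 * (2 * k + D))) := by gcongr
    _ = _ := by rw [hu, mul_one]; field_simp

/-! ### The regularised product: locally uniform convergence and holomorphy -/

/-- The regularised ordered product `∏_{n<N} (1 + [n prime](E_n(z) e^{(z−1)c_n} − 1))` converges locally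
uniformly on `|z| < 2` to a holomorphic function (each `E_p` is holomorphic there, the factors are
`1 + O(p⁻²)`; Mathlib's `Summable.hasProdLocallyUniformlyOn_one_add`). [folklore] -/
theorem exists_differentiableOn_tendsto_prod (hf : IsBatemanHornSystem f) :
    ∃ Φ : ℂ → ℂ, DifferentiableOn ℂ Φ (Metric.ball 0 2) ∧ ∀ z ∈ Metric.ball (0 : ℂ) 2,
      Tendsto (fun N : ℕ => ∏ n ∈ range N, (1 + if n.Prime then
        localFactor f n z * Complex.exp ((z - 1) *
          (((k : ℝ) * Real.log (1 - 1 / (n : ℝ)) + ((k : ℝ) - polyRootCountMod f n) / n : ℝ) : ℂ)) - 1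
        else 0)) atTop (𝓝 (Φ z)) := by
  obtain ⟨P₁, C, hC0, hC⟩ := exists_norm_localFactor_mul_exp_sub_one_le f hf
  obtain ⟨C', hC'⟩ := exists_polyRootCountMod_prime_pow_le_of_system hf
  set G : ℕ → ℂ → ℂ := fun n z => if n.Prime then
      localFactor f n z * Complex.exp ((z - 1) *
        (((k : ℝ) * Real.log (1 - 1 / (n : ℝ)) + ((k : ℝ) - polyRootCountMod f n) / n : ℝ) : ℂ)) - 1
      else 0 with hG
  have hdiff : ∀ n, DifferentiableOn ℂ (G n) (Metric.ball 0 2) := by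
    intro n
    by_cases hn : n.Prime
    · simp only [hG, hn, if_true]
      exact ((differentiableOn_localFactor f hn.two_le (hC' n hn)).fun_mul
        (by fun_prop)).sub_const 1
    · simp only [hG, hn, if_false]
      exact differentiableOn_const 0
  have hbound : ∀ᶠ n in cofinite, ∀ z ∈ Metric.ball (0 : ℂ) 2, ‖G n z‖ ≤ C / (n : ℝ) ^ 2 := by
    rw [Nat.cofinite_eq_atTop, eventually_atTop]
    refine ⟨P₁ + 1, fun n hn z hz => ?_⟩
    simp only [hG]
    split_ifs with hn'
    · exact hC n hn' (by omega) z (mem_ball_zero_iff.mp hz).le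
    · rw [norm_zero]
      positivity
  have hsum : Summable fun n : ℕ => C / (n : ℝ) ^ 2 := by
    simpa [div_eq_mul_one_div C] using (Real.summable_one_div_nat_pow.mpr one_lt_two).mul_left C
  have hprod := hsum.hasProdLocallyUniformlyOn_one_add Metric.isOpen_ball hbound
    fun n => (hdiff n).continuousOn
  have htend := hprod.tendstoLocallyUniformlyOn_finsetRange
  exact ⟨_, htend.differentiableOn (Eventually.of_forall fun N =>
      DifferentiableOn.fun_finsetProd fun n _ => (hdiff n).const_add 1)
    Metric.isOpen_ball, fun z hz => htend.tendsto_at hz⟩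

/-! ### The partial products of `eulerFactor f` -/

/-- Regrouping of the partial products of `λ_F`:
`∏_{p≤N} E_p(z)(1 − 1/p)^{k(z−1)}`
`= [∏_{n≤N} (1 + [n prime](E_n(z)e^{(z−1)c_n} − 1))] · exp(−(z−1) Σ_{p≤N} (k − ρ_F(p))/p)`,
`c_p = k log(1 − 1/p) + (k − ρ_F(p))/p` (as on the sibling line). [folklore] -/
theorem eulerPartial_eq (N : ℕ) (z : ℂ) :
    eulerPartial f N z =
      (∏ n ∈ range (N + 1), (1 + if n.Prime then
        localFactor f n z * Complex.exp ((z - 1) *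
          (((k : ℝ) * Real.log (1 - 1 / (n : ℝ)) + ((k : ℝ) - polyRootCountMod f n) / n : ℝ) : ℂ)) - 1
        else 0)) *
      Complex.exp (-((z - 1) *
        ((∑ p ∈ Nat.primesLE N, ((k : ℝ) - polyRootCountMod f p) / p : ℝ) : ℂ))) := by
  have hexp : Complex.exp (-((z - 1) *
      ((∑ p ∈ Nat.primesLE N, ((k : ℝ) - polyRootCountMod f p) / p : ℝ) : ℂ))) =
      ∏ p ∈ Nat.primesLE N,
        Complex.exp (-((z - 1) * ((((k : ℝ) - polyRootCountMod f p) / p : ℝ) : ℂ))) := by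
    rw [← Complex.exp_sum, Complex.ofReal_sum, Finset.mul_sum, ← Finset.sum_neg_distrib]
  unfold eulerPartial
  rw [hexp, Nat.primesLE_eq_filter_range, Finset.prod_filter, Finset.prod_filter,
    ← Finset.prod_mul_distrib]
  refine Finset.prod_congr rfl fun n _ => ?_
  split_ifs with hn
  · rw [add_sub_cancel, mul_assoc (localFactor f n z), ← Complex.exp_add]
    congr 1
    congr 1
    push_cast
    ring
  · simp

/-! ### The registered stub -/

/-- **stub_eulerFactor** (registered stub of the checked skeleton of line `product-anatomy-subcritical`):
for every Bateman–Horn system `f`, the explicit Euler factor `λ_F = eulerFactor f` (ordered limit of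
`∏_{p ≤ N} E_p(z)(1 − 1/p)^{k(z−1)}`, `E_p(z) = 1 + (z − 1) Σ_a ρ_F(p^{a+1}) p^{−a−1} z^a`) is HOLOMORPHIC on
`|z| < 2`: the counts `ρ_F(p^a)` are bounded (so each `E_p` is holomorphic on the ball), the regularised
factors are `1 + O(p⁻²)` (locally uniform convergence), and the compensating scalars converge by the ORDERED
convergence of `Σ_p (k − ρ_F(p))/p` (`AZFG2020_tendsto_sum_sub_omega_div_holds`). [folklore] -/
theorem stub_eulerFactor :
    ∀ (k : ℕ) (f : Fin k → ℤ[X]), IsBatemanHornSystem f →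
      DifferentiableOn ℂ (eulerFactor f) (Metric.ball 0 2) := by
  intro k f hf
  obtain ⟨L, hL⟩ := AZFG2020_tendsto_sum_sub_omega_div_holds k f hf
  obtain ⟨Φ, hΦd, hΦt⟩ := exists_differentiableOn_tendsto_prod f hf
  have hlim : ∀ z ∈ Metric.ball (0 : ℂ) 2,
      Tendsto (fun N : ℕ => eulerPartial f N z) atTop
        (𝓝 (Φ z * Complex.exp (-((z - 1) * (L : ℂ))))) := by
    intro z hz
    refine Tendsto.congr (fun N => (eulerPartial_eq f N z).symm) ?_
    refine ((hΦt z hz).comp (tendsto_add_atTop_nat 1)).mul ?_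
    refine (Complex.continuous_exp.tendsto _).comp ?_
    exact (((Complex.continuous_ofReal.tendsto L).comp hL).const_mul (z - 1)).neg
  have hexpd : DifferentiableOn ℂ (fun z : ℂ => Complex.exp (-((z - 1) * (L : ℂ))))
      (Metric.ball 0 2) := by
    fun_prop
  refine (hΦd.mul hexpd).congr fun z hz => ?_
  exact (hlim z hz).limUnder_eq

end

end Summit.Parity.BatemanHorn.Cruxes.LSDRealSegment.ProductAnatomySubcritical
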